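import Mathlib
import Literature.AlgebraicGeometry.Resolution.CobordantGame
import Literature.AlgebraicGeometry.Resolution.CobordantGameRestriction
import Literature.AlgebraicGeometry.Resolution.CobordantArcLemma
import Literature.AlgebraicGeometry.Resolution.FormalCoordinateChange

/-!
# `WeightedInvariant.GlobalizeLocalDrop`: the canonical game rank off the singular locus
# (the axiom-(ii) side of a weighted resolution datum)

Route `ResolutionOfSingularities/WeightedInvariant`, support item `GlobalizeLocalDrop`
(stmt-ResolutionOfSingularities-14763): `LocalWeightedDrop → WeightedConstruction`.  A weighted
resolution datum (`Literature.….WeightedResolutionDatum`) has an invariant `inv` which is MINIMAL exactly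
at the points where `X` is regular (axiom (ii)).  The item's sketch globalises the canonical game rank
`ρ = CobordantGame.leastRank` of the crux `LocalWeightedDrop` (canonised in the sibling file
`WeightedInvariantGlobalizeLocalDropCanonize.lean`).  This file settles what `ρ` does OFF the singular
germs, over an arbitrary field `k` (no characteristic hypothesis, no route import):

* `wonBy_zero_of_not_isSingular` — in `n ≥ 1` variables every NON-singular germ (zero, a unit, or
  smooth: some linear coefficient `≠ 0`) is won with game value `0`: for a unit or `0` any legal move
  has no singular `s`-saturated successor; for a smooth germ with `∂f/∂xᵢ(0) ≠ 0` the divisorial move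
  `θ = id`, `w = eᵢ` has transforms with the non-zero linear term `∂f/∂xᵢ(0) · cᵢ · s`, so again no
  successor is singular (`two_le_order_X_pow_mul`, `wonBy_zero_of_order_transform_lt_two`: a singular
  successor forces the transform into `𝔪²`).  Hence `leastRank_eq_zero_of_not_isSingular`, and over a
  field where every singular germ is won (e.g. under `LocalWeightedDrop`) EVERY germ in `n ≥ 1` variables
  is won (`won_of_allSingularWon`), so `leastRank` is the honest game value everywhere.
* `leastRank_does_not_detect_singularity` — but `ρ` is ALSO `0` at singular germs won in one move
  (`y₁²` in two variables, `CobordantGame.wonBy_zero_X_sq`, in the tree), so `ρ` alone violates axiom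
  (ii); a datum built from the game must use e.g. `inv = 0` off the singular locus and `1 + ρ` on it
  (the singular/regular bit is itself upper semicontinuous and smooth-functorial).  Recorded for the
  planner; it does not affect the open steps (2)–(3) of the item.
* `leastRank_cyl_fin_zero` — the degenerate slot of (H3) (cylinders of series in no variables are
  constants, value `0`), used by the packaging file `WeightedInvariantGlobalizeLocalDropHorned.lean`.
-/

set_option linter.dupNamespace false -- mandated namespace of this single-conjunct summit

namespace Summit.ResolutionOfSingularities.ResolutionOfSingularities.Theorems

open Literature.AlgebraicGeometry.Resolution
open Literature.AlgebraicGeometry.Resolution.CobordantGame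

variable {k : Type} [Field k]

/-! ### 1. Transforms and successors -/

/-- A substitution by series without constant terms does not change the constant term (copy of the
sibling file's `constantCoeff_subst_of_constantCoeff_zero`, kept private to avoid the route import). -/
private theorem constantCoeff_subst_eq {n : ℕ} {τ : Type*} (a : Fin n → MvPowerSeries τ k)
    (ha : ∀ i, MvPowerSeries.constantCoeff (a i) = 0) (u : MvPowerSeries (Fin n) k) :
    MvPowerSeries.constantCoeff (MvPowerSeries.subst a u) = MvPowerSeries.constantCoeff u := by
  have has := MvPowerSeries.hasSubst_of_constantCoeff_zero ha
  have hsplit : u = MvPowerSeries.C (MvPowerSeries.constantCoeff u) +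
      (u - MvPowerSeries.C (MvPowerSeries.constantCoeff u)) := by ring
  conv_lhs => rw [hsplit]
  rw [MvPowerSeries.subst_add has, MvPowerSeries.subst_C, map_add, MvPowerSeries.constantCoeff_C,
    MvPowerSeries.constantCoeff_subst_eq_zero has ha (by simp), add_zero]

/-- The components of the crux's chart have zero constant terms (copy of the sibling file's
`constantCoeff_cruxChart`). -/
private theorem constantCoeff_cruxChart' {n : ℕ} (w : Fin n → ℕ) (c : Fin n → k) (i : Fin n) :
    MvPowerSeries.constantCoeff (cruxChart k w c i) = 0 := by
  unfold cruxChart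
  split_ifs with h
  · simp [MvPowerSeries.constantCoeff_X, zero_pow (Nat.pos_iff_ne_zero.mp h)]
  · simp [MvPowerSeries.constantCoeff_X]

/-- A variable has order `1`. -/
private theorem order_X_eq_one {m : ℕ} (s : Fin m) : (MvPowerSeries.X s : MvPowerSeries (Fin m) k).order = 1 := by
  rw [MvPowerSeries.X_def, MvPowerSeries.order_monomial_of_ne_zero one_ne_zero, Finsupp.degree_single,
    Nat.cast_one]

/-- A SINGULAR SUCCESSOR FORCES THE TRANSFORM INTO `𝔪²`: if `g` is a singular `s`-saturated successor of
`f` under `(θ, w)` at `c` then the transform `sᵃ · g` has order `≥ 2`. -/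
theorem two_le_order_X_pow_mul {m : ℕ} (a : ℕ) {g : MvPowerSeries (Fin (m + 1)) k}
    (hg : MvPowerSeries.constantCoeff g = 0 ∧ ∀ j, MvPowerSeries.coeff (Finsupp.single j 1) g = 0) :
    2 ≤ (MvPowerSeries.X (0 : Fin (m + 1)) ^ a * g).order := by
  rw [← FormalCoordChange.two_le_order_iff] at hg
  exact hg.trans (le_trans le_add_self MvPowerSeries.le_order_mul)

/-- The identity substitution `X` has the identity matrix as linear part. -/
theorem linMat_X_eq_one {n : ℕ} :
    (Matrix.of fun i j : Fin n => MvPowerSeries.coeff (Finsupp.single j 1)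
      (MvPowerSeries.X i : MvPowerSeries (Fin n) k)) = 1 := by
  classical
  ext i j
  rw [Matrix.of_apply, MvPowerSeries.coeff_X, Matrix.one_apply]
  by_cases h : i = j
  · subst h; simp
  · rw [if_neg, if_neg h]
    intro h'
    exact h ((Finsupp.single_left_injective Nat.one_ne_zero) h').symm

/-- The divisorial identity move `θ = X`, `w = eᵢ` (weight `1` on the slot `i`, `0` elsewhere) is legal. -/
theorem isMove_X_single {n : ℕ} (i : Fin n) :
    IsMove k (MvPowerSeries.X : Fin n → MvPowerSeries (Fin n) k) (Pi.single i 1) := by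
  refine ⟨fun m => MvPowerSeries.constantCoeff_X m, ?_, ⟨i, by simp⟩⟩
  rw [linMat_X_eq_one, Matrix.det_one]
  exact isUnit_one

/-! ### 2. Non-singular germs are won with value `0` -/

/-- ONE-MOVE WIN FROM LOW ORDER: if some legal move `(θ, w)` has ALL its transforms (at the exceptional
points off the vertex) of order `< 2`, then `f` is won with value `0` (no successor is singular). -/
theorem wonBy_zero_of_order_transform_lt_two {n : ℕ} {f : MvPowerSeries (Fin n) k}
    (θ : Fin n → MvPowerSeries (Fin n) k) (w : Fin n → ℕ) (hm : IsMove k θ w)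
    (hlow : ∀ c : Fin n → k, (∃ i, 0 < w i ∧ c i ≠ 0) →
      (MvPowerSeries.subst (cruxChart k w c) (MvPowerSeries.subst θ f)).order < 2) :
    WonBy k 0 n f := by
  rw [wonBy_zero_iff]
  refine ⟨θ, w, hm, fun g hg => ?_⟩
  obtain ⟨c, a, hc, hfac, -, hsing⟩ := hg
  have h2 := two_le_order_X_pow_mul a hsing
  rw [← hfac] at h2
  exact absurd (hlow c hc) (not_lt.mpr h2)

/-- A germ with NON-ZERO CONSTANT TERM (a unit) is won with value `0` in `n ≥ 1` variables: every
transform has the same non-zero constant term. -/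
theorem wonBy_zero_of_constantCoeff_ne_zero {n : ℕ} (hn : 0 < n) {f : MvPowerSeries (Fin n) k}
    (hf : MvPowerSeries.constantCoeff f ≠ 0) : WonBy k 0 n f := by
  refine wonBy_zero_of_order_transform_lt_two MvPowerSeries.X (Pi.single ⟨0, hn⟩ 1)
    (isMove_X_single ⟨0, hn⟩) fun c _ => ?_
  have hT : MvPowerSeries.constantCoeff
      (MvPowerSeries.subst (cruxChart k (Pi.single (⟨0, hn⟩ : Fin n) 1) c)
        (MvPowerSeries.subst (MvPowerSeries.X : Fin n → MvPowerSeries (Fin n) k) f)) ≠ 0 := by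
    rwa [constantCoeff_subst_eq _ (constantCoeff_cruxChart' _ c),
      constantCoeff_subst_eq _ (fun m : Fin n => MvPowerSeries.constantCoeff_X (R := k) m)]
  by_contra hge
  push Not at hge
  apply hT
  rw [← MvPowerSeries.coeff_zero_eq_constantCoeff_apply]
  apply MvPowerSeries.coeff_of_lt_order
  exact lt_of_lt_of_le (by rw [map_zero]; norm_num) hge

/-- The ZERO germ is won with value `0` in `n ≥ 1` variables (it has no successor at all). -/
theorem wonBy_zero_zero {n : ℕ} (hn : 0 < n) : WonBy k 0 n (0 : MvPowerSeries (Fin n) k) := by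
  rw [wonBy_zero_iff]
  refine ⟨MvPowerSeries.X, Pi.single ⟨0, hn⟩ 1, isMove_X_single ⟨0, hn⟩, fun g hg => ?_⟩
  obtain ⟨c, a, -, hfac, hndvd, -⟩ := hg
  have hcs := MvPowerSeries.hasSubst_of_constantCoeff_zero
    (constantCoeff_cruxChart' (k := k) (Pi.single (⟨0, hn⟩ : Fin n) 1) c)
  rw [← MvPowerSeries.coe_substAlgHom MvPowerSeries.HasSubst.X, map_zero,
    ← MvPowerSeries.coe_substAlgHom hcs, map_zero] at hfac
  have hg0 : g = 0 := by
    rcases mul_eq_zero.mp hfac.symm with h1 | h1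
    · exact absurd h1 (pow_ne_zero _ (FormalCoordChange.X_ne_zero' _))
    · exact h1
  exact hndvd (hg0 ▸ dvd_zero _)

/-- The linear coefficient in `s = X 0` of the chart component of the divisorial move `w = eᵢ`:
`cᵢ` in the slot `i`, `0` in the other slots. -/
theorem coeff_single_zero_cruxChart_single {n : ℕ} (i : Fin n) (c : Fin n → k) (m : Fin n) :
    MvPowerSeries.coeff (Finsupp.single (0 : Fin (n + 1)) 1) (cruxChart k (Pi.single i 1) c m) =
      if m = i then c i else 0 := by
  classical
  unfold cruxChart
  by_cases hm : m = i
  · subst hm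
    rw [if_pos rfl, Pi.single_eq_same, if_pos Nat.one_pos, pow_one, mul_add, map_add,
      show (MvPowerSeries.X 0 : MvPowerSeries (Fin (n + 1)) k) * MvPowerSeries.C (c m) =
        MvPowerSeries.C (c m) * MvPowerSeries.X 0 from mul_comm _ _,
      MvPowerSeries.coeff_C_mul, MvPowerSeries.coeff_index_single_self_X, mul_one, add_eq_left]
    apply MvPowerSeries.coeff_of_lt_order
    refine lt_of_lt_of_le ?_ MvPowerSeries.le_order_mul
    rw [order_X_eq_one, order_X_eq_one, Finsupp.degree_single]
    norm_num
  · rw [if_neg hm, Pi.single_eq_of_ne hm, if_neg (lt_irrefl 0), MvPowerSeries.coeff_X, if_neg]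
    intro h
    have := (Finsupp.single_left_injective Nat.one_ne_zero) h
    exact Fin.succ_ne_zero m this.symm

/-- A SMOOTH germ (`f(0) = 0`, `∂f/∂xᵢ(0) ≠ 0` for some `i`) is won with value `0` in `n ≥ 1` variables:
the divisorial move `θ = id`, `w = eᵢ` produces transforms with the linear term `∂f/∂xᵢ(0) · cᵢ · s`,
`cᵢ ≠ 0`. -/
theorem wonBy_zero_of_coeff_single_ne_zero {n : ℕ} {f : MvPowerSeries (Fin n) k} (i : Fin n)
    (hf : MvPowerSeries.coeff (Finsupp.single i 1) f ≠ 0) : WonBy k 0 n f := by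
  classical
  refine wonBy_zero_of_order_transform_lt_two MvPowerSeries.X (Pi.single i 1) (isMove_X_single i)
    fun c hc => ?_
  -- the exceptional point has `cᵢ ≠ 0` (the only positive weight is at `i`)
  have hci : c i ≠ 0 := by
    obtain ⟨i', hwi', hci'⟩ := hc
    by_cases h : i' = i
    · exact h ▸ hci'
    · rw [Pi.single_eq_of_ne h] at hwi'
      exact absurd hwi' (lt_irrefl 0)
  -- the `s`-linear coefficient of the transform is `∂f/∂xᵢ(0) · cᵢ ≠ 0`
  have hT : MvPowerSeries.coeff (Finsupp.single (0 : Fin (n + 1)) 1)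
      (MvPowerSeries.subst (cruxChart k (Pi.single i 1) c)
        (MvPowerSeries.subst (MvPowerSeries.X : Fin n → MvPowerSeries (Fin n) k) f)) ≠ 0 := by
    rw [MvPowerSeries.subst_self, id, CobordantArc.coeff_degree_one_subst (cruxChart k (Pi.single i 1) c)
      (constantCoeff_cruxChart' _ c) f _ (Finsupp.degree_single _ _)]
    simp_rw [coeff_single_zero_cruxChart_single i c, mul_ite, mul_zero, Finset.sum_ite_eq',
      Finset.mem_univ, if_true]
    exact mul_ne_zero hf hci
  by_contra hge
  push Not at hge
  apply hT
  apply MvPowerSeries.coeff_of_lt_order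
  exact lt_of_lt_of_le (by rw [Finsupp.degree_single]; norm_num) hge

/-- NON-SINGULAR GERMS ARE WON WITH VALUE `0` (in `n ≥ 1` variables). -/
theorem wonBy_zero_of_not_isSingular {n : ℕ} (hn : 0 < n) {f : MvPowerSeries (Fin n) k}
    (hf : ¬ IsSingular k f) : WonBy k 0 n f := by
  by_cases h0 : f = 0
  · subst h0; exact wonBy_zero_zero hn
  by_cases hc : MvPowerSeries.constantCoeff f = 0
  · have : ∃ i, MvPowerSeries.coeff (Finsupp.single i 1) f ≠ 0 := by
      by_contra hcon
      push Not at hcon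
      exact hf ⟨h0, hc, hcon⟩
    obtain ⟨i, hi⟩ := this
    exact wonBy_zero_of_coeff_single_ne_zero i hi
  · exact wonBy_zero_of_constantCoeff_ne_zero hn hc

/-- The canonical rank vanishes off the singular germs (`n ≥ 1`). -/
theorem leastRank_eq_zero_of_not_isSingular {n : ℕ} (hn : 0 < n) {f : MvPowerSeries (Fin n) k}
    (hf : ¬ IsSingular k f) : leastRank n f = 0 :=
  nonpos_iff_eq_zero.mp (leastRank_le (wonBy_zero_of_not_isSingular hn hf))

/-- Over a field where every SINGULAR germ is won, EVERY germ in `n ≥ 1` variables is won (the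
non-singular ones in one move). -/
theorem won_of_allSingularWon (hW : ∀ (n : ℕ) (f : MvPowerSeries (Fin n) k), IsSingular k f → Won k n f)
    {n : ℕ} (hn : 0 < n) (f : MvPowerSeries (Fin n) k) : Won k n f := by
  by_cases hf : IsSingular k f
  · exact hW n f hf
  · exact (wonBy_zero_of_not_isSingular hn hf).won

/-! ### 3. The canonical rank does not detect singularity (axiom (ii) needs the singular bit) -/

/-- `y₁²` in two variables is a SINGULAR germ of canonical rank `0` (won in one move,
`CobordantGame.wonBy_zero_X_sq`): the game rank alone is not minimal-exactly-at-regular-germs, so the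
invariant of a datum built from the game must add the singular/regular bit (e.g. `inv = 0` off the
singular locus, `1 + ρ` on it) to meet axiom (ii) of `WeightedResolutionDatum`. -/
theorem leastRank_does_not_detect_singularity :
    IsSingular k (MvPowerSeries.X 0 ^ 2 : MvPowerSeries (Fin 2) k) ∧
      leastRank 2 (MvPowerSeries.X 0 ^ 2 : MvPowerSeries (Fin 2) k) = 0 := by
  have h2 : (2 : ℕ∞) ≤ (MvPowerSeries.X 0 ^ 2 : MvPowerSeries (Fin 2) k).order := by
    rw [pow_two]
    refine le_trans ?_ MvPowerSeries.le_order_mul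
    rw [order_X_eq_one]
    norm_num
  have h2' := (FormalCoordChange.two_le_order_iff _).mp h2
  exact ⟨⟨pow_ne_zero 2 (FormalCoordChange.X_ne_zero' 0), h2'.1, h2'.2⟩,
    nonpos_iff_eq_zero.mp (leastRank_le wonBy_zero_X_sq)⟩

/-! ### 4. Cylinders of series in no variables (the degenerate slot of (H3)) -/

/-- A series in NO variables is the constant `C (f 0)`. -/
theorem eq_C_constantCoeff_of_fin_zero (h : MvPowerSeries (Fin 0) k) :
    h = MvPowerSeries.C (MvPowerSeries.constantCoeff h) := by
  ext e
  rw [Subsingleton.elim e 0, MvPowerSeries.coeff_zero_eq_constantCoeff_apply,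
    MvPowerSeries.coeff_zero_eq_constantCoeff_apply, MvPowerSeries.constantCoeff_C]

/-- The cylinder of a series in no variables is a constant, hence of game value `0` in one variable. -/
theorem leastRank_cyl_fin_zero (j : Fin 1) (h : MvPowerSeries (Fin 0) k) :
    leastRank 1 (MvPowerSeries.subst
      (fun m : Fin 0 => (MvPowerSeries.X (j.succAbove m) : MvPowerSeries (Fin 1) k)) h) = 0 := by
  refine leastRank_eq_zero_of_not_isSingular Nat.one_pos fun hs => ?_
  rw [eq_C_constantCoeff_of_fin_zero h, MvPowerSeries.subst_C] at hs
  obtain ⟨hne, hc, -⟩ := hs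
  rw [MvPowerSeries.constantCoeff_C] at hc
  exact hne (by rw [hc, map_zero])

end Summit.ResolutionOfSingularities.ResolutionOfSingularities.Theorems
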